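import Literature.AlgebraicGeometry.Resolution.HironakaDirectrixSpan
import Literature.AlgebraicGeometry.Resolution.PointBlowupOrderChart
import HarnessLib

/-!
# `τ ≥ 1` at the points of `Σ` (CoP1, proof of Prop. 4.2 / Lemma 4.3)

Topic: `Literature/AlgebraicGeometry/Resolution`. Consequences of the characterization of the
directrix (`HironakaDirectrix.lean`, `HironakaDirectrixSpan.lean`) used tacitly in [CoP1] =
Cossart–Piltant, J. Algebra 320 (2008), proof of Prop. 4.2 and Lemma 4.3 (the case distinction
`τ(x) ∈ {1, 2, 3}` for `x ∈ Σ`): PROVED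

* `linearFormsSubalgebra_bot` — `k[0] = k`;
* `hironakaTau_eq_zero_iff` — **`τ(S) = 0` iff `S` consists of constants**;
  `one_le_hironakaTau` — a non-zero form of positive degree in `S` forces `τ(S) ≥ 1`;
* `exists_mem_initialForms_ne_zero` — for an ideal `J` of a regular local ring of order exactly
  `μ` (`J ⊆ 𝔪^μ`, `J ⊄ 𝔪^{μ+1}`), **`cl_μ(J) ≠ 0`** (the initial form of an element of order `μ`);
* `one_le_hironakaTauAt` — hence **`1 ≤ τ(x)`** for `μ = ord_x J ≥ 1` (and `τ(x) ≤ emb.dim`,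
  `hironakaTauAt_le`).

## Sources

* V. Cossart, O. Piltant, J. Algebra 320 (2008), proof of Prop. 4.2 and Lemma 4.3, pp. 7–8.
  [CossartPiltant2008]
-/

noncomputable section

open MvPolynomial IsLocalRing

namespace Literature.AlgebraicGeometry.Resolution

universe u

section Field

variable (k : Type u) [Field k] {d : ℕ}

/-- `k[T']` for `T' = 0` is the subalgebra of constants. [folklore] -/
theorem linearFormsSubalgebra_bot :
    linearFormsSubalgebra k (⊥ : Submodule k (Module.Dual k (Fin d → k))) = ⊥ := by
  rw [linearFormsSubalgebra, eq_bot_iff]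
  refine Algebra.adjoin_le ?_
  rintro _ ⟨ℓ, hℓ, rfl⟩
  rw [SetLike.mem_coe, Submodule.mem_bot] at hℓ
  subst hℓ
  have : linearFormPoly k (0 : Module.Dual k (Fin d → k)) = 0 := by
    simp [linearFormPoly]
  rw [this]
  exact Subalgebra.zero_mem _

/-- **`τ(S) = 0` iff every element of `S` is a constant.** (`⇐`: constants are invariant under
all translations; `⇒`: `S ⊆ k[T(S)] = k[0] = k`.) [cite: CossartPiltant2008, proof of Prop. 4.2] -/
theorem hironakaTau_eq_zero_iff (S : Set (MvPolynomial (Fin d) k)) :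
    hironakaTau k S = 0 ↔ S ⊆ Set.range (C : k → MvPolynomial (Fin d) k) := by
  constructor
  · intro h0
    have hbot : directrix k S = ⊥ := Submodule.finrank_eq_zero.mp h0
    intro F hF
    have hmem : F ∈ linearFormsSubalgebra k (directrix k S) :=
      subset_linearFormsSubalgebra_directrix k S hF
    rw [hbot, linearFormsSubalgebra_bot, Algebra.mem_bot] at hmem
    obtain ⟨a, rfl⟩ := hmem
    exact ⟨a, (MvPolynomial.algebraMap_eq (R := k) (σ := Fin d)) ▸ rfl⟩
  · intro hS
    have hsub : S ⊆ linearFormsSubalgebra k (⊥ : Submodule k (Module.Dual k (Fin d → k))) := by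
      intro F hF
      obtain ⟨a, rfl⟩ := hS hF
      exact Subalgebra.algebraMap_mem _ a
    have := hironakaTau_le_finrank_of_subset k hsub
    rw [finrank_bot] at this
    exact Nat.le_zero.mp this

/-- **A non-constant form forces `τ ≥ 1`**: if `S` contains a non-zero homogeneous polynomial of
positive degree then `1 ≤ τ(S)`. [cite: CossartPiltant2008, proof of Prop. 4.2] -/
theorem one_le_hironakaTau {S : Set (MvPolynomial (Fin d) k)} {F : MvPolynomial (Fin d) k}
    (hF : F ∈ S) {μ : ℕ} (hμ : 1 ≤ μ) (hhom : F.IsHomogeneous μ) (hF0 : F ≠ 0) :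
    1 ≤ hironakaTau k S := by
  rw [Nat.one_le_iff_ne_zero, Ne, hironakaTau_eq_zero_iff]
  intro hS
  obtain ⟨a, ha⟩ := hS hF
  have h0 : (C a : MvPolynomial (Fin d) k).IsHomogeneous 0 := isHomogeneous_C _ a
  rw [ha] at h0
  have := MvPolynomial.IsHomogeneous.inj_right hhom h0 hF0
  omega

end Field

/-! ## At a point: `cl_μ(J) ≠ 0` for `μ = ord J`, hence `τ ≥ 1` -/

section Local

variable {R : Type u} [CommRing R] [IsRegularLocalRing R] {d : ℕ} (c : Fin d → R)
  (hc : Ideal.span (Set.range c) = maximalIdeal R)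

include hc in
/-- **`cl_μ(J) ≠ 0` when `J` has order exactly `μ`**: an `f ∈ J ∖ 𝔪^{μ+1}` with `J ⊆ 𝔪^μ` is
`F(c)` for a form `F` of degree `μ` with `F̄ ≠ 0` (`exists_isHomogeneous_eval_eq_map_residue_ne_zero`),
and `F̄ ∈ cl_μ(J)`. [cite: CossartPiltant2008, proof of Prop. 4.2] -/
theorem exists_mem_initialForms_ne_zero {J : Ideal R} {μ : ℕ} (hJ : J ≤ maximalIdeal R ^ μ)
    (hJ' : ¬ J ≤ maximalIdeal R ^ (μ + 1)) :
    ∃ G ∈ initialForms c J μ, G ≠ 0 := by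
  obtain ⟨f, hfJ, hf'⟩ := Set.not_subset.mp hJ'
  obtain ⟨F, hF, hFf, hF0⟩ := exists_isHomogeneous_eval_eq_map_residue_ne_zero c hc (hJ hfJ) hf'
  refine ⟨MvPolynomial.map (residue R) F, ⟨F, hF, hFf ▸ hfJ, rfl⟩, fun h0 => hF0 ?_⟩
  -- `F̄ = 0` modulo `𝔪 = (c)`
  ext m
  have := congrArg (MvPolynomial.coeff m) h0
  rw [MvPolynomial.coeff_map, MvPolynomial.coeff_zero, residue_eq_zero_iff] at this
  rw [MvPolynomial.coeff_map, MvPolynomial.coeff_zero, Ideal.Quotient.eq_zero_iff_mem, hc]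
  exact this

include hc in
/-- **`1 ≤ τ` at order `μ ≥ 1`**: for an ideal `J` of a regular local ring with `J ⊆ 𝔪^μ`,
`J ⊄ 𝔪^{μ+1}`, `μ ≥ 1` (i.e. `μ = ord J ≥ 1`, as at the points of `Σ` in [CoP1]),
`1 ≤ τ(cl_μ J) ≤ emb.dim`. [cite: CossartPiltant2008, proof of Prop. 4.2] -/
theorem one_le_hironakaTauAt {J : Ideal R} {μ : ℕ} (hμ : 1 ≤ μ) (hJ : J ≤ maximalIdeal R ^ μ)
    (hJ' : ¬ J ≤ maximalIdeal R ^ (μ + 1)) : 1 ≤ hironakaTauAt c J μ := by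
  obtain ⟨G, hG, hG0⟩ := exists_mem_initialForms_ne_zero c hc hJ hJ'
  exact one_le_hironakaTau (ResidueField R) hG hμ (isHomogeneous_of_mem_initialForms c hG) hG0

end Local

end Literature.AlgebraicGeometry.Resolution

end
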